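import Summits.CriticalPhenomena.PercolationContinuityZ3.Theorems.PercNearOneGluingNoHeavyQuantGluedWindowFarTop
import HarnessLib

/-!
# QUANT lane R8, T-DEC: LEMMA W's pair condition — the NEAR-h HEAVY cell of the two-row regime (h a mid, the bottom copy of `l` HEAVY and compatible into
# `h`: `y(h−l) ≤ T − 2l < h − l`, the top copy reachable: `T < 2l+r+k`; the middle copy fits into the top copy) PROVED WITHOUT THE CONJECTURE by hand —
# the bulk of the heavy-bottom family (arm-1 gen 61, architect)

builds on p205010 (kernel theorem, internal audit signed; external expert review pending)

Support file (`--supports stmt-CriticalPhenomena-4575`), QUANT lane seat prim-quant-arm-1 (gen 61, architect); memo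
`run/shared/lean/prim/quant/prim-quant-arm-1-g61/ARCH-G61.md` §6–§7.  Theorems only; standard axioms, no sorries, no definitions.

THE CELL.  Band frame and price system of `gluedPullback_windowPair_of_lemmaW`; light window pair `(l, h)` (at `T₀`) below a cheap atom `c ≥ h`; two-row regime,
`h` a mid; at the glued target the pair `(l, h)` has become HEAVY (`y(h−l) ≤ T − 2l`) but is still compatible (`T < l + h`); the top copy `A` is reachable
(`T < 2l + r + k`: exact heavy power `ϖ_A` for row `l`; exact heavy or light power `ϖ_B` for row `l+r`), and the middle copy FITS into `A` (`t₁ ≤ t₂ϖ_B`: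
automatic when it is light for `A`, else the hypothesis `q(1−g)(T−2l−2r) ≤ qg(2l+2r+k−T)`).  CERTIFICATE (the far-h one of `…FarH` plus `h` for row `l`): row
`l+r` ↦ the share `θ = t₁/(t₂ϖ_B)` of `A`; row `l` ↦ the rest of `A`, ALL of `h` and `h+r` at the exact heavy power `(h+l−T)/(T−2l) = (1−ν)/ν` of `(l,h)` (valid
for `h+r` by `apow_valid_of_nearer`; the giant rate is larger), and the pool.  The one inequality `(1−γ)(t₀ − (1−θ)t₂ϖ_A) ≤ γt₂(1−y)/y + γ(t₀+t₁)(1−ν)/ν` is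
three lines: `Y·ν ≤ ρ₀` (as in `…FarTop`: `ν·ϖ_A ≤ (ν−ε)·ϖ_B`, `α ≤ t₁ε + t₂κ`), `(1−γ)ρ₀ ≤ (1−y)γ` (`(y−ρ₀)² ≥ 0`), and the identity
`νt₂(1−y)/y + (1−t₂)(1−ν) − (1−y) = (t₂−y)(ν−y)/y ≥ 0` (`t₂ ≥ y`, `ν ≥ y`).  **`gluedPullback_windowPair_twoRow_nearH`** — in the scale-free census this is
≈ 94 % of the region `y(h−l) ≤ T−2l < min(h−l, r+k)` (the largest open piece of the h-mid half after `…LightPair`, ≈ 25 % of the h-mid two-row configurations);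
the excluded case (middle copy heavy for `A` and not fitting, ≈ 6 %) needs the pool/h for row `l+r` as well (memo §7).

HONEST STATUS.  `GluedLemmaW` (flow form), `GluedDominatedMass`, the band, `SiblingStep`, `FarTreeRow` OPEN; RATE class (log\*) / honest sentence of
`run/shared/lean/prim/quant/README.md` unchanged.  [this work].  Nothing here is cited as a published result.  The gluing rows served
[cite: KozmaNitzan2024, Conjecture 3 (p. 15)]; product measure [cite: Grimmett1999, §1.3 p. 10].
-/

set_option maxHeartbeats 4000000

noncomputable section

namespace Summit.CriticalPhenomena.PercolationContinuityZ3.Theorems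
namespace Quant
namespace LawDec

/-- **THE NEAR-h HEAVY CELL OF THE TWO-ROW REGIME (h a mid)**: `y(h−l) ≤ T − 2l` and `T < l + h` (the pair heavy and compatible at the glued target),
`T < 2l + r + k` (the bottom copy can use the top copy), and the middle copy fits into the top copy (light for it, or `q(1−g)(T−2l−2r) ≤ qg(2l+2r+k−T)`)
⟹ `(1−γ)Ψ(l) + γΨ(h) ≤ 0` for every price system and every cheap `c ≥ h` — no `GluedLemmaW`. [this work] -/
theorem gluedPullback_windowPair_twoRow_nearH (x a q g S : ℝ) (B r k j l h c ls : ℕ) (α p : ℕ → ℝ)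
    (hx0 : 0 < x) (hx1 : x < 1) (ha0 : 0 < a) (ha1 : a ≤ 1) (hq0 : 0 < q) (hq1 : q < 1) (hg0 : 0 ≤ g) (hg1 : g ≤ 1) (hr : 1 ≤ r) (hk : 1 ≤ k)
    (hxqg : x ≤ q * g)
    (hlh : l < h) (hhB : h ≤ B) (hhj : h ≤ j) (hwin : j < h + r + k) (hlow : 2 * (l : ℝ) < a * S) (hcomp : a * S < (l : ℝ) + h)
    (hlight : pairGate (a * x) (a * S) l h < a * x)
    (hL2j : l + r + k ≤ j) (hL2mid : a * (S + q * ((r : ℝ) + k * g)) ≤ 2 * ((l : ℝ) + r + k))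
    (hL1low : 2 * ((l : ℝ) + r) < a * (S + q * ((r : ℝ) + k * g))) (hhmid : a * (S + q * ((r : ℝ) + k * g)) ≤ 2 * (h : ℝ))
    (hAcomp : a * (S + q * ((r : ℝ) + k * g)) < 2 * (l : ℝ) + r + k)
    (hheavyT : (a * x) * ((h : ℝ) - l) ≤ a * (S + q * ((r : ℝ) + k * g)) - 2 * (l : ℝ)) (hcompT : a * (S + q * ((r : ℝ) + k * g)) < (l : ℝ) + h)
    (hcase : a * (S + q * ((r : ℝ) + k * g)) - 2 * ((l : ℝ) + r) ≤ (a * x) * (k : ℝ) ∨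
      q * (1 - g) * (a * (S + q * ((r : ℝ) + k * g)) - 2 * ((l : ℝ) + r)) ≤ q * g * (2 * ((l : ℝ) + r) + k - a * (S + q * ((r : ℝ) + k * g))))
    (hhc : h ≤ c) (hcB : c ≤ B) (hcj : c ≤ j)
    (hp : ∀ h, 0 ≤ p h)
    (hαp : ∀ l' h', l' ≤ j → 2 * (l' : ℝ) < a * (S + q * ((r : ℝ) + k * g)) → h' ≤ B + (r + k) →
      (j + 1 ≤ h' ∨ a * (S + q * ((r : ℝ) + k * g)) < (l' : ℝ) + h') →
      α l' ≤ usage (a * x) (a * (S + q * ((r : ℝ) + k * g))) j l' h' * p h')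
    (hcheap : -(gluedPullback (a * (S + q * ((r : ℝ) + k * g))) q g j r k α p c) * (a * x)
      < (1 - a * x) * gluedPullback (a * (S + q * ((r : ℝ) + k * g))) q g j r k α p ls) :
    (1 - pairGate (a * x) (a * S) l h) * gluedPullback (a * (S + q * ((r : ℝ) + k * g))) q g j r k α p l
      + pairGate (a * x) (a * S) l h * gluedPullback (a * (S + q * ((r : ℝ) + k * g))) q g j r k α p h ≤ 0 := by
  -- names (no `set`: the reduction theorem is applied to the original expressions at the end)
  obtain ⟨y, hy⟩ : ∃ y : ℝ, y = a * x := ⟨_, rfl⟩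
  obtain ⟨T, hT⟩ : ∃ T : ℝ, T = a * (S + q * ((r : ℝ) + k * g)) := ⟨_, rfl⟩
  obtain ⟨T₀, hT₀⟩ : ∃ T₀ : ℝ, T₀ = a * S := ⟨_, rfl⟩
  have hy0 : 0 < y := by rw [hy]; exact mul_pos ha0 hx0
  have hyx : y ≤ x := by rw [hy]; nlinarith
  have hy1 : y < 1 := by linarith
  have h1y : 0 < 1 - y := by linarith
  obtain ⟨t1, ht1⟩ : ∃ t1 : ℝ, t1 = q * (1 - g) := ⟨_, rfl⟩
  obtain ⟨t2, ht2⟩ : ∃ t2 : ℝ, t2 = q * g := ⟨_, rfl⟩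
  have ht1p : 0 ≤ t1 := by rw [ht1]; exact mul_nonneg hq0.le (by linarith)
  have ht2p : 0 ≤ t2 := by rw [ht2]; exact mul_nonneg hq0.le hg0
  have ht0p : 0 ≤ 1 - t1 - t2 := by
    rw [ht1, ht2, show 1 - q * (1 - g) - q * g = 1 - q by ring]; linarith
  have hyt2 : y ≤ t2 := by rw [ht2]; linarith
  have hr1 : (1:ℝ) ≤ r := by exact_mod_cast hr
  have hk0 : (0:ℝ) ≤ k := Nat.cast_nonneg k
  have hr0 : (0:ℝ) ≤ r := by linarith
  have hlh' : (l : ℝ) < h := by exact_mod_cast hlh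
  -- geometry: d = h − l, N = T − 2l, A = T − T₀ ≤ m = t1 r + t2 (r+k)
  obtain ⟨d, hd⟩ : ∃ d : ℝ, d = (h : ℝ) - l := ⟨_, rfl⟩
  have hd0 : 0 < d := by rw [hd]; linarith
  obtain ⟨N, hN⟩ : ∃ N : ℝ, N = T - 2 * (l : ℝ) := ⟨_, rfl⟩
  have hA : T - T₀ = a * (q * ((r : ℝ) + k * g)) := by rw [hT, hT₀]; ring
  have em : q * (1 - g) * (r : ℝ) + q * g * ((r : ℝ) + k) = q * ((r : ℝ) + k * g) := by ring
  have hAm : T - T₀ ≤ t1 * r + t2 * ((r : ℝ) + k) := by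
    rw [hA, ht1, ht2]
    have h1 : a * (q * ((r : ℝ) + k * g)) ≤ 1 * (q * ((r : ℝ) + k * g)) :=
      mul_le_mul_of_nonneg_right ha1 (by positivity)
    linarith [h1, em]
  have hA0 : 0 ≤ T - T₀ := by rw [hA]; positivity
  have hN0 : 0 < N := by rw [hN, hT]; linarith
  have hNK : N < (r : ℝ) + k := by rw [hN, hT]; linarith              -- row l compatible with A
  have hNyd : y * d ≤ N := by rw [hN, hd, hT, hy]; exact hheavyT      -- heavy at T
  have hNd : N < d := by rw [hN, hd, hT]; linarith [hcompT]      -- compatible with h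
  have hN2d : N ≤ 2 * d := by rw [hN, hd, hT]; linarith
  have h2rN : 2 * (r : ℝ) < N := by rw [hN, hT]; linarith
  -- y (r+k) ≤ a m ≤ N: the bottom copy is HEAVY for the top copy (automatic in the band)
  have hxq : x ≤ q := le_trans hxqg (by nlinarith)
  have hxK : x * ((r : ℝ) + k) ≤ q * ((r : ℝ) + k * g) := by
    have e1 : x * (r : ℝ) ≤ q * r := mul_le_mul_of_nonneg_right hxq hr0
    have e2 : x * (k : ℝ) ≤ q * g * k := mul_le_mul_of_nonneg_right hxqg hk0
    linarith [e1, e2]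
  have hyK : y * ((r : ℝ) + k) ≤ N := by
    have e1 : y * ((r : ℝ) + k) ≤ T - T₀ := by
      rw [hy, hA, mul_assoc]; exact mul_le_mul_of_nonneg_left hxK ha0.le
    rw [hN]; rw [hT₀] at e1; linarith
  -- the light gate of the first factor
  obtain ⟨ρ₀, hρ₀⟩ : ∃ ρ₀ : ℝ, ρ₀ = (T₀ - 2 * (l : ℝ)) / ((h : ℝ) - l) := ⟨_, rfl⟩
  have hρ₀y : ρ₀ < y := by
    have : (T₀ - 2 * (l : ℝ)) / ((h : ℝ) - l) ≤ pairGate y T₀ l h := le_max_left _ _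
    rw [hρ₀]; rw [hy, hT₀] at this ⊢; linarith
  obtain ⟨γ, hγ⟩ : ∃ γ : ℝ, γ = y ^ 2 + (1 - y) * ρ₀ := ⟨_, rfl⟩
  have hγ' : pairGate (a * x) (a * S) l h = γ := by
    rw [hγ, hρ₀, hT₀, hy]; exact pairGate_eq_light (a * x) (a * S) l h (mul_pos ha0 hx0).le (by rw [← hy, ← hT₀, ← hρ₀]; exact hρ₀y.le)
  have eρ₀ : ρ₀ = (N - (T - T₀)) / d := by rw [hρ₀, hN, hd]; congr 1; ring
  have hρ₀0 : 0 < ρ₀ := by rw [hρ₀]; exact div_pos (by rw [hT₀]; linarith) (by linarith)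
  have hγ0 : 0 < γ := by rw [hγ]; exact add_pos_of_pos_of_nonneg (pow_pos hy0 2) (mul_pos h1y hρ₀0).le
  have h1γ : 0 < 1 - γ := by
    rw [hγ, show 1 - (y ^ 2 + (1 - y) * ρ₀) = (1 - y) * (1 + y - ρ₀) by ring]; exact mul_pos h1y (by linarith)
  have hlowl : 2 * (l : ℝ) < T := by linarith
  have eLr : ((l + r : ℕ) : ℝ) = (l : ℝ) + r := by push_cast; ring
  have eL2 : ((l + r + k : ℕ) : ℝ) = (l : ℝ) + r + k := by push_cast; ring
  have hlowlr : 2 * ((l + r : ℕ) : ℝ) < T := by rw [eLr]; linarith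
  -- the top copy A = l + r + k: exact heavy power for row l
  obtain ⟨ϖA, hϖA⟩ : ∃ ϖA : ℝ, ϖA = ((l : ℝ) + ((l + r + k : ℕ) : ℝ) - T) / (T - 2 * (l : ℝ)) := ⟨_, rfl⟩
  have hAcomp' : T < (l : ℝ) + ((l + r + k : ℕ) : ℝ) := by rw [eL2]; rw [hN] at hNK; linarith
  have hAheavy : y * ((((l + r + k : ℕ) : ℝ)) - l) ≤ T - 2 * (l : ℝ) := by rw [eL2, ← hN]; linarith [hyK]
  have vA : ϖA * usage y T j l (l + r + k) ≤ 1 := by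
    have e := GluedWindow.apow_heavy_valid y T 1 j l (l + r + k) hy0 hy1 hL2j hlowl hAcomp' hAheavy
    rw [← hϖA, one_mul] at e
    exact e.le
  have eϖA : ϖA = ((r : ℝ) + k - N) / N := by rw [hϖA, eL2, hN]; congr 1; ring
  have hϖA0 : 0 ≤ ϖA := by rw [eϖA]; exact div_nonneg (by linarith) hN0.le
  -- box coordinates
  obtain ⟨nu, hnu⟩ : ∃ nu : ℝ, nu = N / d := ⟨_, rfl⟩
  obtain ⟨ee, hee⟩ : ∃ ee : ℝ, ee = (r : ℝ) / d := ⟨_, rfl⟩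
  obtain ⟨kk, hkk⟩ : ∃ kk : ℝ, kk = ((r : ℝ) + k) / d := ⟨_, rfl⟩
  obtain ⟨aa, haa⟩ : ∃ aa : ℝ, aa = (T - T₀) / d := ⟨_, rfl⟩
  have hnuy : y ≤ nu := by rw [hnu, le_div_iff₀ hd0]; exact hNyd
  have hnu1 : nu < 1 := by rw [hnu, div_lt_one hd0]; exact hNd
  have hee0 : 0 ≤ ee := by rw [hee]; positivity
  have hn0 : 0 < nu := lt_of_lt_of_le hy0 hnuy
  have hn2 : 2 * ee < nu := by
    rw [hee, hnu, show 2 * ((r : ℝ) / d) = (2 * r) / d by ring]; exact div_lt_div_of_pos_right h2rN hd0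
  have hkkn : nu < kk := by rw [hkk, hnu]; exact div_lt_div_of_pos_right hNK hd0
  have hkky : y * kk ≤ nu := by rw [hkk, hnu, ← mul_div_assoc]; exact div_le_div_of_nonneg_right hyK hd0.le
  have eϖA' : ϖA = (kk - nu) / nu := by rw [eϖA, hnu, hkk, ← sub_div, div_div_div_cancel_right₀ hd0.ne']
  have eρ₀' : ρ₀ = nu - aa := by rw [eρ₀, hnu, haa, sub_div]
  have haamax : aa ≤ t1 * ee + t2 * kk := by
    rw [haa, hee, hkk, show t1 * ((r : ℝ) / d) + t2 * (((r : ℝ) + k) / d) = (t1 * r + t2 * ((r : ℝ) + k)) / d by ring]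
    exact div_le_div_of_nonneg_right hAm hd0.le
  -- the copies of h for row l: exact heavy power of (l, h), valid for h + r too (nearer-to-farther)
  obtain ⟨ph, hph⟩ : ∃ ph : ℝ, ph = ((l : ℝ) + h - T) / (T - 2 * (l : ℝ)) := ⟨_, rfl⟩
  have hcompa : T < (l : ℝ) + h := by rw [hT]; exact hcompT
  have vH : ph * usage y T j l h ≤ 1 := by
    have e := GluedWindow.apow_heavy_valid y T 1 j l h hy0 hy1 hhj hlowl hcompa (by rw [← hN, ← hd]; exact hNyd)
    rw [← hph, one_mul] at e
    exact e.le
  have eph : ph = (1 - nu) / nu := by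
    rw [hph, hnu, show (l : ℝ) + h - T = d - N by rw [hd, hN]; ring, ← hN, one_sub_div hd0.ne', div_div_div_cancel_right₀ hd0.ne']
  have hph0 : 0 ≤ ph := by rw [eph]; exact div_nonneg (by linarith) hn0.le
  have vG : ph * usage y T j l (h + r) ≤ 1 ∨ j < h + r := by
    by_cases hjr : h + r ≤ j
    · exact Or.inl (GluedWindow.apow_valid_of_nearer y T ph j l h (h + r) hy0 hy1 hph0 (by omega) hjr hlowl hcompa vH)
    · exact Or.inr (by omega)
  -- the pool power (plain giant rate) and the core inequality
  obtain ⟨pu, hpu⟩ : ∃ pu : ℝ, pu = (1 - y) / y := ⟨_, rfl⟩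
  have hpu0 : 0 ≤ pu := by rw [hpu]; exact div_nonneg h1y.le hy0.le
  have vP : pu * (y / (1 - y)) ≤ 1 := by rw [hpu, div_mul_div_comm, mul_comm (1 - y) y, div_self (mul_ne_zero hy0.ne' h1y.ne')]
  have core : (1 - γ) * ρ₀ ≤ γ * (1 - y) := by
    have := farTop_core y y ρ₀ hy0 hy1 le_rfl hρ₀0.le
    rw [← hγ, mul_assoc, mul_div_cancel₀ _ hy0.ne'] at this; exact this
  have hpuh : ph ≤ pu := by rw [eph, hpu, div_le_div_iff₀ hn0 hy0]; nlinarith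
  have et0 : 1 - t1 - t2 = 1 - q := by rw [ht1, ht2]; ring
  -- the middle copy into A, by status, and the certificate
  obtain ⟨ι, hι⟩ : ∃ ι : ℝ, (h + r ≤ j ∧ ι = 0) ∨ (j < h + r ∧ ι = 1) := by
    by_cases hjr : h + r ≤ j
    · exact ⟨0, Or.inl ⟨hjr, rfl⟩⟩
    · exact ⟨1, Or.inr ⟨by omega, rfl⟩⟩
  -- generic final step: given a valid power ϖB ≥ 0 for (l+r, A) with ν ϖA ≤ (ν − ee) ϖB and t1 ≤ t2 ϖB
  have finish : ∀ ϖB : ℝ, 0 ≤ ϖB → ϖB * usage y T j (l + r) (l + r + k) ≤ 1 → nu * ϖA ≤ (nu - ee) * ϖB → t1 ≤ t2 * ϖB →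
      (1 - pairGate (a * x) (a * S) l h) * gluedPullback (a * (S + q * ((r : ℝ) + k * g))) q g j r k α p l
        + pairGate (a * x) (a * S) l h * gluedPullback (a * (S + q * ((r : ℝ) + k * g))) q g j r k α p h ≤ 0 := by
    intro ϖB hϖB0 vB hratio hfit
    have hBcomp' : T < ((l + r : ℕ) : ℝ) + ((l + r + k : ℕ) : ℝ) := by rw [eLr, eL2]; rw [hN] at hNK; linarith
    · -- row l+r ↦ θ of A; row l ↦ 1−θ of A, every copy of h at the power ph, and the whole pool
      have ht2pos : 0 < t2 := lt_of_lt_of_le hy0 hyt2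
      obtain ⟨θ, hθ0, hθ1, hθc⟩ : ∃ θ : ℝ, 0 ≤ θ ∧ θ ≤ 1 ∧ θ * (t2 * ϖB) = t1 := by
        by_cases hB0 : t2 * ϖB = 0
        · refine ⟨0, le_rfl, zero_le_one, ?_⟩
          rw [hB0] at hfit; rw [zero_mul]; linarith
        · have hBpos : 0 < t2 * ϖB := lt_of_le_of_ne (mul_nonneg ht2p hϖB0) (Ne.symm hB0)
          exact ⟨t1 / (t2 * ϖB), div_nonneg ht1p hBpos.le, (div_le_one hBpos).mpr hfit, div_mul_cancel₀ _ hBpos.ne'⟩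
      -- main (i): (1−γ)(t0 − (1−θ) t2 ϖA) ≤ γ t2 pu
      have hYν : ((1 - t1 - t2) - (1 - θ) * t2 * ϖA) * nu ≤ ρ₀ := by
        have e1 : ((1 - t1 - t2) - (1 - θ) * t2 * ϖA) * nu = nu - t1 * nu - t2 * (nu + nu * ϖA) + θ * t2 * (nu * ϖA) := by ring
        have e2 : nu + nu * ϖA = kk := by rw [eϖA', mul_div_cancel₀ _ hn0.ne']; ring
        have h3 : θ * t2 * (nu * ϖA) ≤ θ * t2 * ((nu - ee) * ϖB) := mul_le_mul_of_nonneg_left hratio (mul_nonneg hθ0 ht2p)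
        have e4 : θ * t2 * ((nu - ee) * ϖB) = θ * (t2 * ϖB) * (nu - ee) := by ring
        rw [e4, hθc] at h3
        rw [e1, e2]
        linarith [h3, haamax, eρ₀']
      have hrhs0 : 0 ≤ γ * t2 * pu + γ * ((1 - t1 - t2) + t1) * ph := by
        have := mul_nonneg (mul_nonneg hγ0.le ht2p) hpu0
        have := mul_nonneg (mul_nonneg hγ0.le (show (0:ℝ) ≤ (1 - t1 - t2) + t1 by linarith)) hph0
        linarith
      have main : (1 - γ) * ((1 - t1 - t2) - (1 - θ) * t2 * ϖA) ≤ γ * t2 * pu + γ * ((1 - t1 - t2) + t1) * ph := by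
        by_cases hYs : (1 - t1 - t2) - (1 - θ) * t2 * ϖA ≤ 0
        · exact le_trans (mul_nonpos_of_nonneg_of_nonpos h1γ.le hYs) hrhs0
        · have hYpos : 0 < (1 - t1 - t2) - (1 - θ) * t2 * ϖA := lt_of_not_ge hYs
          -- (1−γ) Y ν ≤ (1−γ) ρ₀ ≤ γ (1−y) ≤ γ (ν t2 pu + (1 − t2)(1 − ν))  [(t2 − y)(ν − y) ≥ 0]
          have h1 : (1 - γ) * (((1 - t1 - t2) - (1 - θ) * t2 * ϖA) * nu) ≤ γ * (1 - y) :=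
            le_trans (mul_le_mul_of_nonneg_left hYν h1γ.le) core
          have h2 : γ * (1 - y) ≤ γ * (nu * t2 * pu + ((1 - t1 - t2) + t1) * (1 - nu)) := by
            refine mul_le_mul_of_nonneg_left ?_ hγ0.le
            have e : nu * t2 * pu + ((1 - t1 - t2) + t1) * (1 - nu) - (1 - y) = (t2 - y) * (nu - y) / y := by
              rw [hpu]; field_simp; ring
            have : 0 ≤ (t2 - y) * (nu - y) / y := div_nonneg (mul_nonneg (by linarith) (by linarith)) hy0.le
            linarith
          have e3 : γ * (nu * t2 * pu + ((1 - t1 - t2) + t1) * (1 - nu)) = (γ * t2 * pu + γ * ((1 - t1 - t2) + t1) * ph) * nu := by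
            rw [eph]; field_simp
          rw [e3] at h2
          have h4 : (1 - γ) * ((1 - t1 - t2) - (1 - θ) * t2 * ϖA) * nu ≤ (γ * t2 * pu + γ * ((1 - t1 - t2) + t1) * ph) * nu := by
            linarith [h1, h2]
          exact le_of_mul_le_mul_right h4 hn0
      have h1θ : 0 ≤ 1 - θ := by linarith
      by_cases hjr : h + r ≤ j
      · have vG' : ph * usage y T j l (h + r) ≤ 1 := by rcases vG with h1 | h1; exacts [h1, absurd hjr (by omega)]
        have hι' : ι = 0 := by rcases hι with ⟨_, e⟩ | ⟨h1, _⟩; exacts [e, absurd hjr (by omega)]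
        refine gluedPullback_windowPair_twoRow_mid_of_assign x a q g S B r k j l h c ls α p ι ϖA ph ph pu ϖB 0 0 pu
          (1 - θ) 1 1 1 θ 0 0 0
          hx0 hx1 ha0 ha1 hq0 hq1 hg0 hg1 hr hlh hhB hwin hlow hcomp hL2j hL2mid hL1low hhmid hι hhc hcB hcj hp hαp hcheap
          hϖA0 hph0 hph0 hpu0 hϖB0 le_rfl le_rfl hpu0 h1θ zero_le_one zero_le_one zero_le_one hθ0 le_rfl le_rfl le_rfl
          (by linarith) (by linarith) (by linarith) (by linarith)
          ?_ (Or.inr ?_) ?_ (Or.inr ?_) ?_ (Or.inr (Or.inr ?_)) (Or.inl ?_) ?_ (Or.inr ?_) ?_ (Or.inl rfl) ?_ (Or.inl rfl) (Or.inl ?_) ?_ ?_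
        · rw [← hy, ← hT]; exact vA
        · rw [← hT, ← eL2]; exact hAcomp'
        · rw [← hy, ← hT]; exact vH
        · rw [← hT]; exact hcompa
        · rw [← hy, ← hT]; exact vG'
        · rw [← hT]; linarith [hcompa, hr0]
        · rw [← hy]; exact vP
        · rw [← hy, ← hT]; exact vB
        · rw [← hT, ← eL2, ← eLr]; exact hBcomp'
        · rw [zero_mul]; exact zero_le_one
        · rw [zero_mul]; exact zero_le_one
        · rw [← hy]; exact vP
        · rw [hγ', ← ht1, ← ht2, ← et0, hι']
          have e : (1 - θ) * ((1 - γ) * t2 * ϖA) + 1 * (γ * (1 - t1 - t2) * ph) + 1 * (γ * t1 * (1 - 0) * ph) + 1 * (γ * (t2 + 0 * t1) * pu)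
              = (1 - γ) * ((1 - θ) * t2 * ϖA) + γ * t2 * pu + γ * ((1 - t1 - t2) + t1) * ph := by ring
          rw [e]; linarith [main]
        · rw [hγ', ← ht1, ← ht2]
          have e : θ * ((1 - γ) * t2 * ϖB) + 0 * (γ * (1 - q) * 0) + 0 * (γ * t1 * (1 - ι) * 0) + 0 * (γ * (t2 + ι * t1) * pu)
              = θ * (t2 * ϖB) * (1 - γ) := by ring
          rw [e, hθc, mul_comm]
      · have hι' : ι = 1 := by rcases hι with ⟨h1, _⟩ | ⟨_, e⟩; exacts [absurd h1 hjr, e]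
        refine gluedPullback_windowPair_twoRow_mid_of_assign x a q g S B r k j l h c ls α p ι ϖA ph 0 pu ϖB 0 0 pu
          (1 - θ) 1 1 1 θ 0 0 0
          hx0 hx1 ha0 ha1 hq0 hq1 hg0 hg1 hr hlh hhB hwin hlow hcomp hL2j hL2mid hL1low hhmid hι hhc hcB hcj hp hαp hcheap
          hϖA0 hph0 le_rfl hpu0 hϖB0 le_rfl le_rfl hpu0 h1θ zero_le_one zero_le_one zero_le_one hθ0 le_rfl le_rfl le_rfl
          (by linarith) (by linarith) (by linarith) (by linarith)
          ?_ (Or.inr ?_) ?_ (Or.inr ?_) ?_ (Or.inl rfl) (Or.inl ?_) ?_ (Or.inr ?_) ?_ (Or.inl rfl) ?_ (Or.inl rfl) (Or.inl ?_) ?_ ?_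
        · rw [← hy, ← hT]; exact vA
        · rw [← hT, ← eL2]; exact hAcomp'
        · rw [← hy, ← hT]; exact vH
        · rw [← hT]; exact hcompa
        · rw [zero_mul]; exact zero_le_one
        · rw [← hy]; exact vP
        · rw [← hy, ← hT]; exact vB
        · rw [← hT, ← eL2, ← eLr]; exact hBcomp'
        · rw [zero_mul]; exact zero_le_one
        · rw [zero_mul]; exact zero_le_one
        · rw [← hy]; exact vP
        · rw [hγ', ← ht1, ← ht2, ← et0, hι']
          have e : (1 - θ) * ((1 - γ) * t2 * ϖA) + 1 * (γ * (1 - t1 - t2) * ph) + 1 * (γ * t1 * (1 - 1) * 0) + 1 * (γ * (t2 + 1 * t1) * pu)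
              = (1 - γ) * ((1 - θ) * t2 * ϖA) + γ * t2 * pu + γ * (1 - t1 - t2) * ph + γ * t1 * pu := by ring
          rw [e]
          have : γ * t1 * ph ≤ γ * t1 * pu := mul_le_mul_of_nonneg_left hpuh (mul_nonneg hγ0.le ht1p)
          linarith [main]
        · rw [hγ', ← ht1, ← ht2]
          have e : θ * ((1 - γ) * t2 * ϖB) + 0 * (γ * (1 - q) * 0) + 0 * (γ * t1 * (1 - ι) * 0) + 0 * (γ * (t2 + ι * t1) * pu)
              = θ * (t2 * ϖB) * (1 - γ) := by ring
          rw [e, hθc, mul_comm]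
  -- instantiate by the status of the middle copy w.r.t. A
  by_cases hBst : y * (k : ℝ) < N - 2 * (r : ℝ)
  · -- heavy: exact heavy power
    obtain ⟨ϖB, hϖB⟩ : ∃ ϖB : ℝ, ϖB = (((l + r : ℕ) : ℝ) + ((l + r + k : ℕ) : ℝ) - T) / (T - 2 * ((l + r : ℕ) : ℝ)) := ⟨_, rfl⟩
    have hBcomp' : T < ((l + r : ℕ) : ℝ) + ((l + r + k : ℕ) : ℝ) := by rw [eLr, eL2]; rw [hN] at hNK; linarith
    have hBheavy' : y * ((((l + r + k : ℕ) : ℝ)) - ((l + r : ℕ) : ℝ)) ≤ T - 2 * ((l + r : ℕ) : ℝ) := by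
      rw [eL2, eLr, show (l : ℝ) + r + k - ((l : ℝ) + r) = k by ring]; rw [hN] at hBst; linarith [hBst]
    have vB : ϖB * usage y T j (l + r) (l + r + k) ≤ 1 := by
      have e := GluedWindow.apow_heavy_valid y T 1 j (l + r) (l + r + k) hy0 hy1 hL2j hlowlr hBcomp' hBheavy'
      rw [← hϖB, one_mul] at e
      exact e.le
    have eϖB1 : ϖB = ((r : ℝ) + k + r - N) / (N - 2 * (r : ℝ)) := by rw [hϖB, eL2, eLr, hN]; congr 1 <;> ring
    have eϖB : ϖB = (kk + ee - nu) / (nu - 2 * ee) := by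
      rw [eϖB1, hkk, hee, hnu, ← add_div, ← sub_div, show N / d - 2 * ((r : ℝ) / d) = (N - 2 * r) / d by ring,
        div_div_div_cancel_right₀ hd0.ne']
    have hϖB0 : 0 ≤ ϖB := by rw [eϖB]; exact div_nonneg (by linarith) (by linarith)
    refine finish ϖB hϖB0 vB ?_ ?_
    · rw [eϖA', eϖB]; exact farTop_ratio_heavy nu ee kk hee0 hn2 hkkn.le
    · -- the fit hypothesis (the light disjunct contradicts the heavy status)
      rcases hcase with h1 | h1
      · exfalso; rw [hy, hN, hT] at hBst; linarith
      · rw [eϖB1, ← mul_div_assoc, le_div_iff₀ (by linarith : (0:ℝ) < N - 2 * (r : ℝ)), ht1, ht2]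
        rw [hN, hT]; linarith [h1]
  · -- light: exact light power
    have hBlight : N - 2 * (r : ℝ) ≤ y * (k : ℝ) := le_of_not_gt hBst
    obtain ⟨ρB, hρB⟩ : ∃ ρB : ℝ, ρB = (T - 2 * ((l + r : ℕ) : ℝ)) / ((((l + r + k : ℕ) : ℝ)) - ((l + r : ℕ) : ℝ)) := ⟨_, rfl⟩
    have hk0' : (0:ℝ) < k := by linarith
    have eρB : ρB = (N - 2 * (r : ℝ)) / k := by rw [hρB, eL2, eLr, hN]; congr 1 <;> ring
    have hρBy : ρB ≤ y := by rw [eρB, div_le_iff₀ hk0']; linarith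
    have hρB0 : 0 ≤ ρB := by rw [eρB]; exact div_nonneg (by linarith) hk0'.le
    obtain ⟨GB, hGB⟩ : ∃ GB : ℝ, GB = y ^ 2 + (1 - y) * ρB := ⟨_, rfl⟩
    have hGBy : GB ≤ y := by rw [hGB]; nlinarith [mul_le_mul_of_nonneg_left hρBy h1y.le]
    have hGB0 : 0 < GB := by rw [hGB]; exact add_pos_of_pos_of_nonneg (pow_pos hy0 2) (mul_nonneg h1y.le hρB0)
    have hGB1 : 0 < 1 - GB := by linarith
    obtain ⟨ϖB, hϖB⟩ : ∃ ϖB : ℝ, ϖB = (1 - GB) / GB := ⟨_, rfl⟩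
    have hϖB0 : 0 ≤ ϖB := by rw [hϖB]; exact div_nonneg hGB1.le hGB0.le
    have vB : ϖB * usage y T j (l + r) (l + r + k) ≤ 1 := by
      rw [usage_light_eq y T j (l + r) (l + r + k) hy0.le hL2j (by rw [← hρB]; exact hρBy), ← hρB, ← hGB, hϖB, div_mul_div_comm,
        mul_comm (1 - GB) GB, div_self (mul_ne_zero hGB0.ne' hGB1.ne')]
    have eρB' : ρB = (nu - 2 * ee) / (kk - ee) := by
      rw [eρB, hnu, hee, hkk, ← sub_div, show N / d - 2 * ((r : ℝ) / d) = (N - 2 * r) / d by ring, show (r : ℝ) + k - r = k by ring,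
        div_div_div_cancel_right₀ hd0.ne']
    have hBl : nu - 2 * ee ≤ y * (kk - ee) := by
      rw [hnu, hee, hkk, show N / d - 2 * ((r : ℝ) / d) = (N - 2 * r) / d by ring, show y * (((r : ℝ) + k) / d - (r : ℝ) / d) = (y * k) / d by ring]
      exact div_le_div_of_nonneg_right hBlight hd0.le
    -- row l+r always fits: t1 ≤ 1 − y ≤ t2 ϖB
    have hfit : t1 ≤ t2 * ϖB := by
      have hϖBge : (1 - y) / y ≤ ϖB := by rw [hϖB, div_le_div_iff₀ hy0 hGB0]; nlinarith [hGBy]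
      have h1 : 1 - y ≤ t2 * ϖB := by
        calc 1 - y = y * ((1 - y) / y) := by field_simp
          _ ≤ t2 * ϖB := mul_le_mul hyt2 hϖBge (div_nonneg h1y.le hy0.le) ht2p
      linarith
    refine finish ϖB hϖB0 vB ?_ hfit
    rw [eϖA', hϖB, hGB, eρB']; exact farTop_ratio_light y nu ee kk hy0 hy1 hee0 hn2 hkkn hkky hBl

end LawDec
end Quant
end Summit.CriticalPhenomena.PercolationContinuityZ3.Theorems
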